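import Literature.Analysis.FluidPDE.LeiZhang2011LogSlice
import Literature.Analysis.FluidPDE.LeiZhang2011TimeArgument
import Literature.Analysis.FluidPDE.LeiZhang2011MoserLevel
import Literature.Analysis.FluidPDE.LeiZhang2011EnergyAxis
import Literature.Analysis.FluidPDE.LeiZhang2011StreamL6
import Literature.Analysis.FluidPDE.NashNonlinearities
import Literature.Analysis.FluidPDE.SpaceTimeAxisIntegrable
import HarnessLib

/-!
# Lei–Zhang 2011, Lemma 3.2 (tree form): the logarithmic estimate

Analysis/FluidPDE proofs file (theorems only), on the discharge path of the named fact
`Literature.Analysis.FluidPDE.LeiZhang2011_liouville` (Z. Lei, Q. S. Zhang, J. Funct. Anal. 261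
(2011) = arXiv:1011.5066, Theorem 1.2). Lemma 3.2 of the paper: for a positive solution
`Φ ≤ 2` of (1.5) on `P(R)` which is a constant `≥ 1` on the axis and has mass
`‖Φ‖_{L¹(P(R/2))} ≥ c₀R⁵`, `−∫ ζ_R² ln Φ(·,t) ≤ M₀(1 + ‖b‖_E²)` for `t ∈ [−c₀R²/4, 0]`.

* `log_slice_bound` — the slice inequality behind (3.5): in the `H`-calculus of the tree
  (`energy_identity_axis` with `H = −log`, cut-off `φ = radialCutoff (ρ/2) ρ`, `Z = ∫φ²`),
  `−(G₁ + T₁) + T₂ + (T₃ + Bd) ≤ −½ ∫‖∇Ψ‖²φ² + k₁ρ − (A/Z) ∫Ψφ²` with `Ψ = −ln F`, combining the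
  slice estimates of `LeiZhang2011LogSlice` and the John–Nirenberg inequality with `p = 2`;
* `log_estimate` — **Lemma 3.2 in the tree's form**: for every `BMO` bound `C_B` and mass constant
  `m₀ > 0` there are `c_t ∈ (0, 1/8]` and `M₀` such that for every radius `ρ`, every
  `0 < ε ≤ 1` and every solution `F` of the swirl-type equation in the setting at radius `ρ`
  with `ε ≤ F ≤ 3` on the cylinder, `F ≥ 1` on the axis and
  `∫_{−ρ²/4}^0 ∫_{B̄(ρ/2)} F^{1/4} ≥ m₀ρ⁵` (the output of Lemma 3.4, `lower_mass`),
  `∫ (−ln F(t,·)) φ² ≤ M₀ ρ³` for all `t ∈ [−c_tρ², 0]` (the time argument of p. 10,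
  `le_threshold_or_riccati`).

## References

* Z. Lei, Q. S. Zhang, J. Funct. Anal. 261 (2011) = arXiv:1011.5066, Lemma 3.2 and its proof,
  pp. 9–10. [LeiZhang2011]
-/

noncomputable section

open MeasureTheory Set Function Filter Metric intervalIntegral
open _root_.Topology
open scoped InnerProductSpace RealInnerProductSpace NNReal ENNReal Laplacian

namespace Literature.Analysis.FluidPDE

namespace LeiZhang2011

open Literature.Analysis.FunctionSpaces Literature.Analysis.Pluripotential

/-- **The slice inequality of Lemma 3.2** (Lei–Zhang 2011, p. 9, the estimate leading to
"`∂ₜ∫Ψζ² + C∫Ψζ² ≤ −½∫|∇Ψ|²ζ² + C(1 + ‖b‖²_E)`"). At one time slice, for `F ∈ C²` axisymmetric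
with `ε ≤ F ≤ 3` on `B̄(0,ρ)` and `F ≥ 1` on the axis, `H ∈ C²` with `H = −log`, `H' = −1/v`,
`H'' = 1/v²` on `[ε/2, ∞)`, a drift `b = curl B` a.e. with `B` differentiable and
`‖B‖_BMO ≤ C_B`, and the cut-off `φ = radialCutoff (ρ/2) ρ`: the integrand of
`energy_identity_axis` (with `η ≡ 1`) is bounded by
`−½ G + k₁ ρ − (A/Z) Y`, `G = ∫H'(F)²‖∇F‖²φ²`, `Y = ∫H(F)φ²`, `Z = ∫φ²`, `A = 2c₂∫φ(0,0,z)²dz`,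
`k₁ = 24C_φ²|B₁|(1 + C₂C_B²) + (393216/9)C_T²|B₁|`. [cite: LeiZhang2011, proof of Lemma 3.2 (arXiv p. 9)] -/
theorem log_slice_bound {ρ ε : ℝ} (hρ : 0 < ρ) (hε : 0 < ε)
    {F : EuclideanSpace ℝ (Fin 3) → ℝ} (hF : ContDiff ℝ 2 F) (hFa : IsAxisymmetricScalar F)
    (hFb : ∀ x ∈ closedBall (0 : EuclideanSpace ℝ (Fin 3)) ρ, ε ≤ F x ∧ F x ≤ 3)
    (hFax : ∀ z : ℝ, |z| ≤ ρ → 1 ≤ F (meridianPoint (0, z)))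
    {H : ℝ → ℝ} (hH : ContDiff ℝ 2 H) (hHeq : ∀ v, ε / 2 ≤ v → H v = -Real.log v)
    (hHd1 : ∀ v, ε / 2 < v → deriv H v = -v⁻¹)
    (hHd2 : ∀ v, ε / 2 < v → deriv (deriv H) v = (v ^ 2)⁻¹)
    {b Bst : EuclideanSpace ℝ (Fin 3) → EuclideanSpace ℝ (Fin 3)} (hb : LocallyIntegrable b volume)
    (hBst : Differentiable ℝ Bst) (hcurl : curl Bst =ᵐ[volume] b) {CB : ℝ≥0}
    {Cφ CT C2 : ℝ} (hC2 : 0 ≤ C2)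
    (hCφ : ∀ z : EuclideanSpace ℝ (Fin 3),
      ‖gradient (radialCutoff (ρ / 2) ρ : EuclideanSpace ℝ (Fin 3) → ℝ) z‖ ≤ Cφ / (ρ - ρ / 2))
    (hCT : ∀ t, |deriv Real.smoothTransition t| ≤ CT)
    (hJN : ∃ c : EuclideanSpace ℝ (Fin 3),
      ∫ x in closedBall (0 : EuclideanSpace ℝ (Fin 3)) ρ, ‖Bst x - c‖ ^ 2 ≤
        C2 * (CB : ℝ) ^ 2 * volume.real (ball (0 : EuclideanSpace ℝ (Fin 3)) ρ)) :
    -((∫ x, deriv (deriv H) (F x) * ‖gradient F x‖ ^ 2 * radialCutoff (ρ / 2) ρ x ^ 2) +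
        ∫ x, deriv H (F x) * ⟪gradient F x,
          gradient (fun y => (radialCutoff (ρ / 2) ρ : EuclideanSpace ℝ (Fin 3) → ℝ) y ^ 2) x⟫) +
      (∫ x, H (F x) * ⟪b x,
          gradient (fun y => (radialCutoff (ρ / 2) ρ : EuclideanSpace ℝ (Fin 3) → ℝ) y ^ 2) x⟫) +
      ((∫ x, 2 / cylRadius x * (H (F x) *
          fderiv ℝ (fun y => (radialCutoff (ρ / 2) ρ : EuclideanSpace ℝ (Fin 3) → ℝ) y ^ 2) x (eR x))) +
        2 * radialConst₂ * ∫ z : ℝ, H (F (meridianPoint (0, z))) * radialCutoff (ρ / 2) ρ (meridianPoint (0, z)) ^ 2) ≤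
      -(1 / 2) * (∫ x, deriv H (F x) ^ 2 * ‖gradient F x‖ ^ 2 * radialCutoff (ρ / 2) ρ x ^ 2) +
        (24 * Cφ ^ 2 * volume.real (ball (0 : EuclideanSpace ℝ (Fin 3)) 1) * (1 + C2 * (CB : ℝ) ^ 2) +
          393216 / 9 * CT ^ 2 * volume.real (ball (0 : EuclideanSpace ℝ (Fin 3)) 1)) * ρ -
        (2 * radialConst₂ * ∫ z : ℝ, radialCutoff (ρ / 2) ρ (meridianPoint (0, z)) ^ 2) /
            (∫ y : EuclideanSpace ℝ (Fin 3), radialCutoff (ρ / 2) ρ y ^ 2) *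
          ∫ x, H (F x) * radialCutoff (ρ / 2) ρ x ^ 2 := by
  -- ### the cut-off
  have hT3 := integral_axis_term_log_le hρ (Ψ := fun x => H (F x))
    ((hH.of_le one_le_two).comp (hF.of_le one_le_two)) (fun θ x => by simp only [hFa θ x]) hCT
    (δ := 1 / 6) (by norm_num)
  set φ : EuclideanSpace ℝ (Fin 3) → ℝ := radialCutoff (ρ / 2) ρ with hφdef
  set V₁ : ℝ := volume.real (ball (0 : EuclideanSpace ℝ (Fin 3)) 1) with hV₁
  set K : Set (EuclideanSpace ℝ (Fin 3)) := closedBall 0 ρ with hK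
  have hρ2 : 0 ≤ ρ / 2 := by positivity
  have hρρ : ρ / 2 < ρ := half_lt_self hρ
  have hφ : ContDiff ℝ 2 φ := radialCutoff_contDiff _ _
  have hφ1C : ContDiff ℝ 1 φ := radialCutoff_contDiff _ _
  have hφcs : HasCompactSupport φ := hasCompactSupport_radialCutoff hρ2 hρρ
  have hφK : tsupport φ ⊆ K := tsupport_radialCutoff_subset_closedBall hρ2 hρρ
  have hφ0K : ∀ x, x ∉ K → φ x = 0 := fun x hx => image_eq_zero_of_notMem_tsupport fun h => hx (hφK h)
  have hφ01 : ∀ x, 0 ≤ φ x ∧ φ x ≤ 1 := fun x => ⟨radialCutoff_nonneg _ _ _, radialCutoff_le_one _ _ _⟩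
  have hKc : IsCompact K := isCompact_closedBall _ _
  have hV₁0 : 0 < V₁ := by
    rw [hV₁, measureReal_def]
    exact ENNReal.toReal_pos (measure_ball_pos volume _ one_pos).ne' measure_ball_lt_top.ne
  have hfin : Module.finrank ℝ (EuclideanSpace ℝ (Fin 3)) = 3 := finrank_euclideanSpace_fin
  have hVK : volume.real K = ρ ^ 3 * V₁ := by
    have h1 := Measure.addHaar_real_closedBall (volume : Measure (EuclideanSpace ℝ (Fin 3)))
      (0 : EuclideanSpace ℝ (Fin 3)) hρ.le
    rwa [hfin] at h1
  have hVb : volume.real (ball (0 : EuclideanSpace ℝ (Fin 3)) ρ) = ρ ^ 3 * V₁ := by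
    rw [← Measure.addHaar_real_closedBall_eq_addHaar_real_ball]; exact hVK
  -- the gradient bound `‖∇φ‖ ≤ D = 2Cφ/ρ`, `∇φ = 0` off `K`
  set D : ℝ := Cφ / (ρ - ρ / 2) with hD
  have hφD : ∀ x, ‖gradient φ x‖ ≤ D := fun x => hCφ x
  have hD0 : 0 ≤ D := (norm_nonneg _).trans (hφD 0)
  have hD2 : D ^ 2 = 4 * Cφ ^ 2 / ρ ^ 2 := by
    rw [hD, show ρ - ρ / 2 = ρ / 2 by ring, div_pow]; field_simp; ring
  have hgradφK : ∀ x, x ∉ K → gradient φ x = 0 := fun x hx =>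
    gradient_eq_zero_of_notMem_tsupport fun h => hx (hφK h)
  have hgradφc : Continuous (gradient φ) := continuous_gradient_of_contDiff hφ1C
  -- ### notation for the slice functionals
  set G : ℝ := ∫ x, deriv H (F x) ^ 2 * ‖gradient F x‖ ^ 2 * φ x ^ 2 with hG
  set Y : ℝ := ∫ x, H (F x) * φ x ^ 2 with hY
  have hG0 : 0 ≤ G := integral_nonneg fun x => by positivity
  -- ### the link `H''(F) = H'(F)²` on `K`
  have hlink : ∀ x, deriv (deriv H) (F x) * ‖gradient F x‖ ^ 2 * φ x ^ 2 =
      deriv H (F x) ^ 2 * ‖gradient F x‖ ^ 2 * φ x ^ 2 := by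
    intro x
    by_cases hx : x ∈ K
    · have hv : ε / 2 < F x := (half_lt_self hε).trans_le (hFb x hx).1
      rw [hHd2 _ hv, hHd1 _ hv, neg_sq, inv_pow]
    · rw [hφ0K x hx]; ring
  have hG₁ : ∫ x, deriv (deriv H) (F x) * ‖gradient F x‖ ^ 2 * φ x ^ 2 = G := by
    rw [hG]; exact integral_congr_ae (ae_of_all _ hlink)
  -- ### `T₁`: the viscous cut-off term
  have hgradφi : ∫ x, ‖gradient φ x‖ ^ 2 ≤ D ^ 2 * (ρ ^ 3 * V₁) := by
    have hpt : ∀ x, ‖gradient φ x‖ ^ 2 ≤ K.indicator (fun _ => D ^ 2) x := by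
      intro x
      by_cases hx : x ∈ K
      · rw [indicator_of_mem hx]
        exact pow_le_pow_left₀ (norm_nonneg _) (hφD x) 2
      · rw [indicator_of_notMem hx, hgradφK x hx, norm_zero, zero_pow two_ne_zero]
    calc ∫ x, ‖gradient φ x‖ ^ 2 ≤ ∫ x, K.indicator (fun _ => D ^ 2) x :=
          integral_mono_of_nonneg (ae_of_all _ fun x => by positivity)
            ((integrable_indicator_iff hKc.measurableSet).2 (integrableOn_const hKc.measure_lt_top.ne))
            (ae_of_all _ hpt)
      _ = D ^ 2 * (ρ ^ 3 * V₁) := by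
          rw [MeasureTheory.integral_indicator hKc.measurableSet, setIntegral_const, smul_eq_mul, hVK, mul_comm]
  have hT1 := abs_integral_deriv_comp_inner_gradient_le_sq (hF.of_le one_le_two) hH hφ1C hφcs
    (ε := 1 / 6) (by norm_num)
  -- ### `T₂`: the transport term through the stream function, John–Nirenberg with `p = 2`
  obtain ⟨c, hc⟩ := hJN
  have hT2 := abs_integral_comp_inner_gradient_le_sq hF hH hφ hφcs hBst hcurl hb c (ε := 1 / 6) (by norm_num)
  have hBc : ∫ x, ‖Bst x - c‖ ^ 2 * ‖gradient φ x‖ ^ 2 ≤ D ^ 2 * (C2 * (CB : ℝ) ^ 2 * (ρ ^ 3 * V₁)) := by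
    have hpt : ∀ x, ‖Bst x - c‖ ^ 2 * ‖gradient φ x‖ ^ 2 ≤ K.indicator (fun x => D ^ 2 * ‖Bst x - c‖ ^ 2) x := by
      intro x
      by_cases hx : x ∈ K
      · rw [indicator_of_mem hx, mul_comm]
        exact mul_le_mul_of_nonneg_right (pow_le_pow_left₀ (norm_nonneg _) (hφD x) 2) (sq_nonneg _)
      · rw [indicator_of_notMem hx, hgradφK x hx, norm_zero, zero_pow two_ne_zero, mul_zero]
    have hBi : IntegrableOn (fun x => D ^ 2 * ‖Bst x - c‖ ^ 2) K volume :=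
      ((continuous_const.mul ((hBst.continuous.sub continuous_const).norm.pow 2)).continuousOn.integrableOn_compact hKc)
    calc ∫ x, ‖Bst x - c‖ ^ 2 * ‖gradient φ x‖ ^ 2 ≤ ∫ x, K.indicator (fun x => D ^ 2 * ‖Bst x - c‖ ^ 2) x :=
          integral_mono_of_nonneg (ae_of_all _ fun x => by positivity)
            ((integrable_indicator_iff hKc.measurableSet).2 hBi) (ae_of_all _ hpt)
      _ = D ^ 2 * ∫ x in K, ‖Bst x - c‖ ^ 2 := by
          rw [MeasureTheory.integral_indicator hKc.measurableSet, MeasureTheory.integral_const_mul]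
      _ ≤ D ^ 2 * (C2 * (CB : ℝ) ^ 2 * (ρ ^ 3 * V₁)) := by
          rw [← hVb]; exact mul_le_mul_of_nonneg_left hc (sq_nonneg _)
  -- ### `T₃`: the axis term (`integral_axis_term_log_le`), in terms of `G` and `Y`
  have hgradΨ : ∫ x, ‖gradient (fun x => H (F x)) x‖ ^ 2 * φ x ^ 2 = G := by
    rw [hG]
    refine integral_congr_ae (ae_of_all _ fun x => ?_)
    dsimp only
    have h := gradient_comp_apply ((hH.differentiable two_ne_zero) (F x)) ((hF.differentiable two_ne_zero) x)
    rw [h, norm_smul, mul_pow, Real.norm_eq_abs, sq_abs]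
  rw [hgradΨ] at hT3
  -- ### the boundary term is non-positive (`F ≥ 1` on the axis, `H = −log`)
  have hBd : 2 * radialConst₂ * ∫ z : ℝ, H (F (meridianPoint (0, z))) * φ (meridianPoint (0, z)) ^ 2 ≤ 0 := by
    have hc₂ : 0 < radialConst₂ := radialConst₂_pos
    have hnp : ∫ z : ℝ, H (F (meridianPoint (0, z))) * φ (meridianPoint (0, z)) ^ 2 ≤ 0 := by
      refine integral_nonpos fun z => ?_
      by_cases hz : φ (meridianPoint (0, z)) = 0
      · rw [hz]; simp
      · have hzK : meridianPoint (0, z) ∈ K := by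
          by_contra h; exact hz (hφ0K _ h)
        have hzρ : |z| ≤ ρ := by
          rw [hK, mem_closedBall_zero_iff, norm_meridianPoint_zero] at hzK; exact hzK
        have h1 := hFax z hzρ
        have hv : ε / 2 ≤ F (meridianPoint (0, z)) := (half_le_self hε.le).trans (hFb _ hzK).1
        rw [hHeq _ hv]
        exact mul_nonpos_of_nonpos_of_nonneg (neg_nonpos.2 (Real.log_nonneg h1)) (sq_nonneg _)
    nlinarith
  -- ### assemble
  have hk₃ : 64 * ρ ^ 2 / (1 / 6) * (32 * CT / (3 * ρ ^ 2)) ^ 2 * (ρ ^ 3 * V₁) = 393216 / 9 * CT ^ 2 * V₁ * ρ := by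
    field_simp
    ring
  have hk₁ : 6 * (D ^ 2 * (ρ ^ 3 * V₁)) + 6 * (D ^ 2 * (C2 * (CB : ℝ) ^ 2 * (ρ ^ 3 * V₁))) =
      24 * Cφ ^ 2 * V₁ * (1 + C2 * (CB : ℝ) ^ 2) * ρ := by
    rw [hD2]; field_simp; ring
  rw [hk₃] at hT3
  have h1 := (neg_le_abs _).trans hT1   -- `−T₁ ≤ |T₁|`
  have h2 := (le_abs_self _).trans hT2
  rw [hG₁]
  have e6 : (1 / 6 : ℝ)⁻¹ = 6 := by norm_num
  rw [e6] at h1 h2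
  linarith [h1, h2, hT3, hBd, hgradφi, hBc, hk₁]


set_option maxHeartbeats 1600000 in
-- one long assembly proof (cut-off, integrability bookkeeping, the energy identity on every
-- sub-interval, the slice inequality a.e., the set `W`, the time argument, constants)
/-- **Lemma 3.2 of Lei–Zhang 2011 (tree form): the logarithmic estimate.** For every `BMO`
bound `C_B` and every mass constant `m₀ > 0` there are `c_t ∈ (0, 1/8]` and `M₀ ≥ 0` such that
for every radius `ρ > 0`, every `0 < ε ≤ 1` and every solution `F` of the swirl-type equation
in the setting at radius `ρ` (hypotheses as in `lower_mass`) with `ε ≤ F ≤ 3` on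
`[−ρ², 0] × B̄(0,ρ)`, `F ≥ 1` at the axis points of the cylinder and the mass bound
`∫_{−ρ²/4}^0 ∫_{B̄(0,ρ/2)} F^{1/4} ≥ m₀ρ⁵`, one has `∫ (−ln F(t,·)) φ² ≤ M₀ ρ³` for all
`t ∈ [−c_tρ², 0]`, `φ = radialCutoff (ρ/2) ρ` (printed: "`−∫ζ_R² ln Φ(x,t)dx ≤ M₀(1 + ‖b‖²_E)` for
all `t ∈ [−c₀R²/4, 0]`"). [cite: LeiZhang2011, Lemma 3.2 (arXiv pp. 9–10)] -/
theorem log_estimate (CB : ℝ≥0) {m₀ : ℝ} (hm₀ : 0 < m₀) :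
    ∃ ct M₀ : ℝ, 0 < ct ∧ ct ≤ 1 / 8 ∧ 0 ≤ M₀ ∧ ∀ ⦃ρ : ℝ⦄, 0 < ρ → ∀ ⦃ε : ℝ⦄, 0 < ε → ε ≤ 1 →
      ∀ ⦃F N : ℝ → EuclideanSpace ℝ (Fin 3) → ℝ⦄
        ⦃b Bst : ℝ → EuclideanSpace ℝ (Fin 3) → EuclideanSpace ℝ (Fin 3)⦄,
      (∀ s, ContDiff ℝ 2 (F s)) → (∀ s, IsAxisymmetricScalar (F s)) →
      (∀ s, LocallyIntegrable (b s) volume) →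
      (∀ᵐ s ∂(volume.restrict (Ioc (-ρ ^ 2) 0)),
        Differentiable ℝ (Bst s) ∧ curl (Bst s) =ᵐ[volume] b s ∧ eBMOSeminormVec (Bst s) ≤ CB) →
      (∀ s x, N s x =
        (Δ (F s)) x - fderiv ℝ (F s) x (b s x) - 2 / cylRadius x * fderiv ℝ (F s) x (eR x)) →
      (∀ᵐ x ∂(volume : Measure (EuclideanSpace ℝ (Fin 3))),
        IntervalIntegrable (fun s => N s x) volume (-ρ ^ 2) 0 ∧
          ∀ s ∈ Icc (-ρ ^ 2) 0, F s x = F (-ρ ^ 2) x + ∫ τ in (-ρ ^ 2)..s, N τ x) →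
      (Continuous fun p : ℝ × EuclideanSpace ℝ (Fin 3) => F p.1 p.2) →
      (Continuous fun p : ℝ × EuclideanSpace ℝ (Fin 3) => gradient (F p.1) p.2) →
      AEStronglyMeasurable (fun p : ℝ × EuclideanSpace ℝ (Fin 3) => N p.1 p.2)
        ((volume.restrict (Ioc (-ρ ^ 2) 0)).prod volume) →
      Integrable (fun p : ℝ × EuclideanSpace ℝ (Fin 3) => N p.1 p.2)
        ((volume.restrict (Ioc (-ρ ^ 2) 0)).prod (volume.restrict (closedBall 0 ρ))) →
      AEStronglyMeasurable (fun p : ℝ × EuclideanSpace ℝ (Fin 3) => b p.1 p.2)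
        ((volume.restrict (Ioc (-ρ ^ 2) 0)).prod volume) →
      ∀ ⦃Mb : ℝ⦄, (∀ s, ∀ x ∈ closedBall (0 : EuclideanSpace ℝ (Fin 3)) ρ, ‖b s x‖ ≤ Mb) →
      (∀ s ∈ Icc (-ρ ^ 2) 0, ∀ x ∈ closedBall (0 : EuclideanSpace ℝ (Fin 3)) ρ, ε ≤ F s x ∧ F s x ≤ 3) →
      (∀ s ∈ Icc (-ρ ^ 2) 0, ∀ z : ℝ, |z| ≤ ρ → 1 ≤ F s (meridianPoint (0, z))) →
      m₀ * ρ ^ 5 ≤ ∫ s in (-(ρ ^ 2 / 4))..0,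
        ∫ x in closedBall (0 : EuclideanSpace ℝ (Fin 3)) (ρ / 2), F s x ^ (1 / 4 : ℝ) →
      ∀ t ∈ Icc (-(ct * ρ ^ 2)) 0,
        ∫ x, -Real.log (F t x) * radialCutoff (ρ / 2) ρ x ^ 2 ≤ M₀ * ρ ^ 3 := by
  -- ### the absolute constants
  obtain ⟨Cφ, hCφ0, hCφ⟩ := exists_norm_gradient_radialCutoff_le
  obtain ⟨CT, hCT0, hCT⟩ := exists_abs_deriv_smoothTransition_le
  obtain ⟨C2, hC20, hC2⟩ := exists_setIntegral_norm_sub_sq_le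
  have hc₂ : 0 < radialConst₂ := radialConst₂_pos
  set V₁ : ℝ := volume.real (ball (0 : EuclideanSpace ℝ (Fin 3)) 1) with hV₁
  have hV₁0 : 0 < V₁ := by
    rw [hV₁, measureReal_def]
    exact ENNReal.toReal_pos (measure_ball_pos volume _ one_pos).ne' measure_ball_lt_top.ne
  have hlog3 : 0 < Real.log 3 := Real.log_pos (by norm_num)
  -- the derived constants (all depending only on `CB`, `m₀` and absolute constants)
  set k₁ : ℝ := 24 * Cφ ^ 2 * V₁ * (1 + C2 * (CB : ℝ) ^ 2) + 393216 / 9 * CT ^ 2 * V₁ with hk₁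
  set kK : ℝ := k₁ + 4 * radialConst₂ * Real.log 3 with hkK
  set θ₀ : ℝ := 2 * m₀ with hθ₀
  set m₁ : ℝ := 16 / 27 * θ₀ ^ 4 * 512 / V₁ ^ 3 with hm₁
  set w₀ : ℝ := m₁ / V₁ with hw₀
  set L₀ : ℝ := |Real.log w₀| + 1 with hL₀
  set γ : ℝ := 4 * m₀ / (3 * V₁) with hγ
  set ct : ℝ := min (γ / 2) (1 / 8) with hct
  set M₀ : ℝ := k₁ * V₁ / (2 * radialConst₂) + 2 * L₀ * V₁ + 36864 * V₁ / (w₀ ^ 2 * γ) + kK with hM₀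
  have hk₁0 : 0 ≤ k₁ := by positivity
  have hkK0 : 0 ≤ kK := by positivity
  have hθ₀0 : 0 < θ₀ := by positivity
  have hm₁0 : 0 < m₁ := by positivity
  have hw₀0 : 0 < w₀ := by positivity
  have hL₀0 : 0 < L₀ := by positivity
  have hL₀' : -Real.log w₀ ≤ L₀ := (neg_le_abs _).trans (le_add_of_nonneg_right zero_le_one)
  have hγ0 : 0 < γ := by positivity
  have hct0 : 0 < ct := lt_min (by positivity) (by norm_num)
  have hM₀0 : 0 ≤ M₀ := by positivity
  refine ⟨ct, M₀, hct0, min_le_right _ _, hM₀0, ?_⟩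
  intro ρ hρ ε hε hε1 F N b Bst hF2 hFa hb hBst hN heq hFc hF1c hNm hNi hbm Mb hbB hFb hFax hmass t ht
  -- ### elementary facts
  have hn0 : -ρ ^ 2 ≤ (0 : ℝ) := by nlinarith
  have hρ2 : 0 ≤ ρ / 2 := by positivity
  have hρρ : ρ / 2 < ρ := half_lt_self hρ
  have hq0 : -(ρ ^ 2 / 4) ≤ (0 : ℝ) := by nlinarith
  have hq1 : -ρ ^ 2 ≤ -(ρ ^ 2 / 4) := by nlinarith
  set K : Set (EuclideanSpace ℝ (Fin 3)) := closedBall 0 ρ with hK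
  have hKc : IsCompact K := isCompact_closedBall _ _
  have hfin : Module.finrank ℝ (EuclideanSpace ℝ (Fin 3)) = 3 := finrank_euclideanSpace_fin
  have hVhalf : volume.real (closedBall (0 : EuclideanSpace ℝ (Fin 3)) (ρ / 2)) = (ρ / 2) ^ 3 * V₁ := by
    have h1 := Measure.addHaar_real_closedBall (volume : Measure (EuclideanSpace ℝ (Fin 3)))
      (0 : EuclideanSpace ℝ (Fin 3)) hρ2
    rwa [hfin] at h1
  -- ### the nonlinearity `H = −log ∘ χ_ε`
  obtain ⟨hHC, hHeq0, hHd10, hHd20⟩ := clampedNegLog_props hε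
  obtain ⟨H, hHdef⟩ : ∃ H : ℝ → ℝ, ∀ v, H v = -Real.log (smoothMax (ε / 4) v (ε / 4)) := ⟨_, fun _ => rfl⟩
  have hHfun : (fun v : ℝ => -Real.log (smoothMax (ε / 4) v (ε / 4))) = H := funext fun v => (hHdef v).symm
  rw [hHfun] at hHC hHd10 hHd20
  have hHeq : ∀ v, ε / 2 ≤ v → H v = -Real.log v := fun v hv => by rw [hHdef]; exact hHeq0 v hv
  have hH : ContDiff ℝ 2 H := hHC 2
  have hH1 : ContDiff ℝ 1 H := hHC 1
  -- ### the cut-off (the two masses first, so that `set` folds them)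
  obtain ⟨hZlo, hZhi⟩ := radialCutoff_sq_mass hρ
  obtain ⟨hAlo, hAhi⟩ := radialCutoff_sq_axis_mass hρ
  rw [← hV₁] at hZlo hZhi
  set φ : EuclideanSpace ℝ (Fin 3) → ℝ := radialCutoff (ρ / 2) ρ with hφdef
  have hφ : ContDiff ℝ 2 φ := radialCutoff_contDiff _ _
  have hφ1C : ContDiff ℝ 1 φ := radialCutoff_contDiff _ _
  have hφcs : HasCompactSupport φ := hasCompactSupport_radialCutoff hρ2 hρρ
  have hφa : IsAxisymmetricScalar φ := radialCutoff_axisymmetric _ _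
  have hφK : tsupport φ ⊆ K := tsupport_radialCutoff_subset_closedBall hρ2 hρρ
  have hφ01 : ∀ x, 0 ≤ φ x ∧ φ x ≤ 1 := fun x => ⟨radialCutoff_nonneg _ _ _, radialCutoff_le_one _ _ _⟩
  have hφone : ∀ x ∈ closedBall (0 : EuclideanSpace ℝ (Fin 3)) (ρ / 2), φ x = 1 := fun x hx =>
    radialCutoff_eq_one hρ2 hρρ (mem_closedBall_zero_iff.1 hx)
  have hφ0K : ∀ x, x ∉ K → φ x = 0 := fun x hx => image_eq_zero_of_notMem_tsupport fun h => hx (hφK h)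
  have hφ2 : ContDiff ℝ 1 fun y => φ y ^ 2 := hφ1C.pow 2
  have hgradφ2c : Continuous (gradient fun y => φ y ^ 2) := continuous_gradient_of_contDiff hφ2
  have htsupp2 : tsupport (fun y => φ y ^ 2) ⊆ K := by
    refine (closure_mono ?_).trans ((isClosed_closedBall).closure_subset_iff.2 (subset_tsupport _ |>.trans hφK))
    intro x hx
    simp only [mem_support, ne_eq, pow_eq_zero_iff, OfNat.ofNat_ne_zero, not_false_eq_true] at hx
    exact hx
  have hgradφ2K : ∀ x, x ∉ K → gradient (fun y => φ y ^ 2) x = 0 := fun x hx =>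
    gradient_eq_zero_of_notMem_tsupport fun h => hx (htsupp2 h)
  have hfderivφ2K : ∀ x, x ∉ K → fderiv ℝ (fun y => φ y ^ 2) x = 0 := fun x hx =>
    fderiv_of_notMem_tsupport ℝ fun h => hx (htsupp2 h)
  obtain ⟨D₂, hD₂⟩ : ∃ D₂, ∀ x, ‖gradient (fun y => φ y ^ 2) x‖ ≤ D₂ :=
    hgradφ2c.bounded_above_of_compact_support (HasCompactSupport.intro hKc fun x hx => hgradφ2K x hx)
  have hφ2cs : HasCompactSupport fun y => φ y ^ 2 := hφcs.comp_left (g := fun t : ℝ => t ^ 2) (by simp)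
  have hφ2c : Continuous fun y => φ y ^ 2 := hφ.continuous.pow 2
  -- the two masses of the cut-off and their bounds
  obtain ⟨Z, hZdef⟩ : ∃ Z : ℝ, Z = ∫ y, φ y ^ 2 := ⟨_, rfl⟩
  obtain ⟨A, hAdef⟩ : ∃ A : ℝ, A = 2 * radialConst₂ * ∫ z : ℝ, φ (meridianPoint (0, z)) ^ 2 := ⟨_, rfl⟩
  rw [← hZdef] at hZlo hZhi
  have hZV : Z ≤ ρ ^ 3 * V₁ := hZhi
  have hZpos : 0 < Z := lt_of_lt_of_le (by positivity) hZlo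
  have hA2 : 2 * radialConst₂ * ρ ≤ A := by rw [hAdef]; nlinarith [hAlo, hc₂]
  have hA4 : A ≤ 4 * radialConst₂ * ρ := by rw [hAdef]; nlinarith [hAhi, hc₂]
  have hApos : 0 < A := lt_of_lt_of_le (by positivity) hA2
  -- ### bounds for `H(F)`, `H'(F)` on `[−ρ², 0] × K`
  have hHFc : Continuous fun p : ℝ × EuclideanSpace ℝ (Fin 3) => H (F p.1 p.2) := hH.continuous.comp hFc
  have hH'c : Continuous (deriv H) := hH.continuous_deriv (by norm_num)
  have hH''c : Continuous (deriv (deriv H)) := by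
    have h2 : ContDiff ℝ (1 + 1) H := by rw [one_add_one_eq_two]; exact hH
    exact h2.deriv'.continuous_deriv le_rfl
  have hH'Fc : Continuous fun p : ℝ × EuclideanSpace ℝ (Fin 3) => deriv H (F p.1 p.2) := hH'c.comp hFc
  have hcpt : IsCompact (Icc (-ρ ^ 2) (0 : ℝ) ×ˢ K) := isCompact_Icc.prod hKc
  obtain ⟨CH, hCH⟩ : ∃ C, ∀ p ∈ Icc (-ρ ^ 2) (0 : ℝ) ×ˢ K, ‖H (F p.1 p.2)‖ ≤ C :=
    hcpt.exists_bound_of_continuousOn hHFc.continuousOn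
  obtain ⟨CH', hCH'⟩ : ∃ C, ∀ p ∈ Icc (-ρ ^ 2) (0 : ℝ) ×ˢ K, ‖deriv H (F p.1 p.2)‖ ≤ C :=
    hcpt.exists_bound_of_continuousOn hH'Fc.continuousOn
  have hBst' : ∀ᵐ s ∂(volume.restrict (Ioc (-ρ ^ 2) 0)),
      Differentiable ℝ (Bst s) ∧ curl (Bst s) =ᵐ[volume] b s := by
    filter_upwards [hBst] with s hs
    exact ⟨hs.1, hs.2.1⟩
  -- ### the space–time integrability of `H'(F) N φ²`
  have hint0 : Integrable (fun p : ℝ × EuclideanSpace ℝ (Fin 3) =>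
      deriv H (F p.1 p.2) * N p.1 p.2 * φ p.2 ^ 2) ((volume.restrict (Ioc (-ρ ^ 2) 0)).prod volume) := by
    set μ₁ : Measure (ℝ × EuclideanSpace ℝ (Fin 3)) := (volume.restrict (Ioc (-ρ ^ 2) 0)).prod volume with hμ₁
    have hfm : AEStronglyMeasurable (fun p : ℝ × EuclideanSpace ℝ (Fin 3) =>
        deriv H (F p.1 p.2) * N p.1 p.2 * φ p.2 ^ 2) μ₁ :=
      (hH'Fc.aestronglyMeasurable.mul hNm).mul ((hφ.continuous.comp continuous_snd).pow 2).aestronglyMeasurable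
    set g : ℝ × EuclideanSpace ℝ (Fin 3) → ℝ := fun p =>
      (univ ×ˢ K : Set (ℝ × EuclideanSpace ℝ (Fin 3))).indicator (fun p => CH' * ‖N p.1 p.2‖) p with hg
    have hgi : Integrable g μ₁ := by
      rw [hg, integrable_indicator_iff (MeasurableSet.univ.prod hKc.measurableSet)]
      have hres : μ₁.restrict (univ ×ˢ K) = (volume.restrict (Ioc (-ρ ^ 2) 0)).prod (volume.restrict K) := by
        rw [hμ₁, ← Measure.restrict_univ (μ := volume.restrict (Ioc (-ρ ^ 2) (0:ℝ))),
          Measure.prod_restrict, Measure.restrict_univ]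
      rw [IntegrableOn, hres]
      exact hNi.norm.const_mul CH'
    refine hgi.mono' hfm ?_
    have hmem : ∀ᵐ p ∂μ₁, p.1 ∈ Ioc (-ρ ^ 2) (0 : ℝ) := by
      rw [hμ₁, Measure.restrict_prod_eq_prod_univ]
      filter_upwards [ae_restrict_mem (measurableSet_Ioc.prod MeasurableSet.univ)] with p hp
      exact hp.1
    filter_upwards [hmem] with p hp
    by_cases hx : p.2 ∈ K
    · have hpI : p ∈ Icc (-ρ ^ 2) (0 : ℝ) ×ˢ K := ⟨Ioc_subset_Icc_self hp, hx⟩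
      simp only [hg]
      rw [indicator_of_mem (show p ∈ (univ ×ˢ K : Set _) from ⟨mem_univ _, hx⟩)]
      have h1 : ‖deriv H (F p.1 p.2)‖ ≤ CH' := hCH' p hpI
      have h5 : φ p.2 ^ 2 ≤ 1 := pow_le_one₀ (hφ01 p.2).1 (hφ01 p.2).2
      rw [norm_mul, norm_mul, Real.norm_eq_abs (φ p.2 ^ 2), abs_of_nonneg (sq_nonneg (φ p.2))]
      calc ‖deriv H (F p.1 p.2)‖ * ‖N p.1 p.2‖ * φ p.2 ^ 2 ≤ CH' * ‖N p.1 p.2‖ * 1 :=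
            mul_le_mul (mul_le_mul_of_nonneg_right h1 (norm_nonneg _)) h5 (sq_nonneg _) (by
              exact mul_nonneg ((norm_nonneg _).trans h1) (norm_nonneg _))
        _ = CH' * ‖N p.1 p.2‖ := mul_one _
    · rw [hφ0K p.2 hx]
      simp only [hg]
      rw [indicator_of_notMem (show p ∉ (univ ×ˢ K : Set _) from fun h => hx h.2)]
      simp
  -- ### the slice functionals and their integrability in time
  have hT₂i : IntervalIntegrable (fun s => ∫ x, H (F s x) * ⟪b s x, gradient (fun y => φ y ^ 2) x⟫)
      volume (-ρ ^ 2) 0 := by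
    have hf : Integrable (fun p : ℝ × EuclideanSpace ℝ (Fin 3) =>
        H (F p.1 p.2) * ⟪b p.1 p.2, gradient (fun y => φ y ^ 2) p.2⟫)
        ((volume.restrict (Ioc (-ρ ^ 2) 0)).prod volume) := by
      refine integrable_prod_of_le_mul_one_add_inv_cylRadius (K := K) hKc ?_ ?_ (C := CH * Mb * D₂) ?_
      · exact hHFc.aestronglyMeasurable.mul (hbm.inner (hgradφ2c.comp continuous_snd).aestronglyMeasurable)
      · intro s x hx
        show H (F s x) * ⟪b s x, gradient (fun y => φ y ^ 2) x⟫ = 0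
        rw [hgradφ2K x hx, inner_zero_right, mul_zero]
      · intro s hs x hx
        show |H (F s x) * ⟪b s x, gradient (fun y => φ y ^ 2) x⟫| ≤ CH * Mb * D₂ * (1 + (cylRadius x)⁻¹)
        have h1 : ‖H (F s x)‖ ≤ CH := hCH (s, x) ⟨Ioc_subset_Icc_self hs, hx⟩
        have h2 : ‖b s x‖ ≤ Mb := hbB s x hx
        have h3 := hD₂ x
        have hr0 : 0 ≤ (cylRadius x)⁻¹ := inv_nonneg.2 (cylRadius_nonneg x)
        have hCH0 : 0 ≤ CH := (norm_nonneg _).trans h1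
        have hMb0 : 0 ≤ Mb := (norm_nonneg _).trans h2
        calc |H (F s x) * ⟪b s x, gradient (fun y => φ y ^ 2) x⟫|
            = |H (F s x)| * |⟪b s x, gradient (fun y => φ y ^ 2) x⟫| := abs_mul _ _
          _ ≤ CH * (Mb * D₂) := by
              refine mul_le_mul ((Real.norm_eq_abs _).symm.le.trans h1)
                ((abs_real_inner_le_norm _ _).trans (mul_le_mul h2 h3 (norm_nonneg _) hMb0))
                (abs_nonneg _) hCH0
          _ = CH * Mb * D₂ * 1 := by ring
          _ ≤ CH * Mb * D₂ * (1 + (cylRadius x)⁻¹) := by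
              refine mul_le_mul_of_nonneg_left (le_add_of_nonneg_right hr0) ?_
              exact mul_nonneg (mul_nonneg hCH0 hMb0) ((norm_nonneg _).trans h3)
    have h := hf.integral_prod_left
    exact (intervalIntegrable_iff_integrableOn_Ioc_of_le hn0).2 h
  have hT₃i : IntervalIntegrable
      (fun s => ∫ x, 2 / cylRadius x * (H (F s x) * fderiv ℝ (fun y => φ y ^ 2) x (eR x)))
      volume (-ρ ^ 2) 0 := by
    obtain ⟨D₃, hD₃⟩ : ∃ D₃, ∀ x, ‖fderiv ℝ (fun y => φ y ^ 2) x‖ ≤ D₃ :=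
      (hφ2.continuous_fderiv one_ne_zero).bounded_above_of_compact_support
        (HasCompactSupport.intro hKc fun x hx => hfderivφ2K x hx)
    have hD₃0 : 0 ≤ D₃ := (norm_nonneg _).trans (hD₃ 0)
    have hf : Integrable (fun p : ℝ × EuclideanSpace ℝ (Fin 3) =>
        2 / cylRadius p.2 * (H (F p.1 p.2) * fderiv ℝ (fun y => φ y ^ 2) p.2 (eR p.2)))
        ((volume.restrict (Ioc (-ρ ^ 2) 0)).prod volume) := by
      refine integrable_prod_of_le_mul_one_add_inv_cylRadius (K := K) hKc ?_ ?_ (C := 2 * (CH * D₃)) ?_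
      · have h1 : Measurable fun p : ℝ × EuclideanSpace ℝ (Fin 3) => 2 / cylRadius p.2 :=
          measurable_const.div (continuous_cylRadius.measurable.comp measurable_snd)
        have h2 : Measurable fun p : ℝ × EuclideanSpace ℝ (Fin 3) =>
            fderiv ℝ (fun y => φ y ^ 2) p.2 (eR p.2) := by
          have h : Measurable fun p : ℝ × EuclideanSpace ℝ (Fin 3) =>
              ⟪gradient (fun y => φ y ^ 2) p.2, eR p.2⟫ :=
            Measurable.inner (hgradφ2c.measurable.comp measurable_snd) (measurable_eR.comp measurable_snd)
          have e : (fun p : ℝ × EuclideanSpace ℝ (Fin 3) => fderiv ℝ (fun y => φ y ^ 2) p.2 (eR p.2)) =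
              fun p => ⟪gradient (fun y => φ y ^ 2) p.2, eR p.2⟫ :=
            funext fun p => (inner_gradient_left (fun y => φ y ^ 2) p.2 (eR p.2)).symm
          rw [e]; exact h
        exact h1.aestronglyMeasurable.mul (hHFc.aestronglyMeasurable.mul h2.aestronglyMeasurable)
      · intro s x hx
        show 2 / cylRadius x * (H (F s x) * fderiv ℝ (fun y => φ y ^ 2) x (eR x)) = 0
        rw [hfderivφ2K x hx]; simp
      · intro s hs x hx
        show |2 / cylRadius x * (H (F s x) * fderiv ℝ (fun y => φ y ^ 2) x (eR x))| ≤
          2 * (CH * D₃) * (1 + (cylRadius x)⁻¹)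
        have h1 : ‖H (F s x)‖ ≤ CH := hCH (s, x) ⟨Ioc_subset_Icc_self hs, hx⟩
        have hCH0 : 0 ≤ CH := (norm_nonneg _).trans h1
        have h2 : ‖fderiv ℝ (fun y => φ y ^ 2) x (eR x)‖ ≤ D₃ := by
          calc ‖fderiv ℝ (fun y => φ y ^ 2) x (eR x)‖ ≤ ‖fderiv ℝ (fun y => φ y ^ 2) x‖ * ‖eR x‖ :=
                ContinuousLinearMap.le_opNorm _ _
            _ ≤ D₃ * 1 := mul_le_mul (hD₃ x) (norm_eR_le_one x) (norm_nonneg _) hD₃0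
            _ = D₃ := mul_one _
        have hr0 : 0 ≤ (cylRadius x)⁻¹ := inv_nonneg.2 (cylRadius_nonneg x)
        rw [abs_mul, abs_div, abs_two, abs_of_nonneg (cylRadius_nonneg x), abs_mul, div_eq_mul_inv]
        have h3 : |H (F s x)| * |fderiv ℝ (fun y => φ y ^ 2) x (eR x)| ≤ CH * D₃ :=
          mul_le_mul ((Real.norm_eq_abs _).symm.le.trans h1) ((Real.norm_eq_abs _).symm.le.trans h2)
            (abs_nonneg _) hCH0
        calc 2 * (cylRadius x)⁻¹ * (|H (F s x)| * |fderiv ℝ (fun y => φ y ^ 2) x (eR x)|)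
            ≤ 2 * (cylRadius x)⁻¹ * (CH * D₃) := mul_le_mul_of_nonneg_left h3 (by positivity)
          _ = 2 * (CH * D₃) * (cylRadius x)⁻¹ := by ring
          _ ≤ 2 * (CH * D₃) * (cylRadius x)⁻¹ + 2 * (CH * D₃) * 1 :=
              le_add_of_nonneg_right (mul_nonneg (mul_nonneg zero_le_two (mul_nonneg hCH0 hD₃0)) zero_le_one)
          _ = 2 * (CH * D₃) * (1 + (cylRadius x)⁻¹) := by ring
    have h := hf.integral_prod_left
    exact (intervalIntegrable_iff_integrableOn_Ioc_of_le hn0).2 h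
  -- the boundary functional
  have hmpc : Continuous fun z : ℝ => meridianPoint (0, z) :=
    (contDiff_meridianPoint (n := 0)).continuous.comp (continuous_const.prodMk continuous_id)
  have hφmp0 : ∀ z : ℝ, z ∉ Icc (-ρ) ρ → φ (meridianPoint (0, z)) = 0 := by
    intro z hz
    apply hφ0K
    rw [hK, mem_closedBall_zero_iff, norm_meridianPoint_zero, abs_le]
    rwa [mem_Icc] at hz
  have hBdc : Continuous fun s => 2 * radialConst₂ *
      ∫ z : ℝ, H (F s (meridianPoint (0, z))) * φ (meridianPoint (0, z)) ^ 2 := by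
    have hjc : Continuous fun p : ℝ × ℝ => H (F p.1 (meridianPoint (0, p.2))) * φ (meridianPoint (0, p.2)) ^ 2 :=
      (hHFc.comp (continuous_fst.prodMk (hmpc.comp continuous_snd))).mul
        ((hφ.continuous.comp (hmpc.comp continuous_snd)).pow 2)
    have h := continuous_parametric_integral_of_continuous (μ := (volume : Measure ℝ))
      (f := fun s z => H (F s (meridianPoint (0, z))) * φ (meridianPoint (0, z)) ^ 2) hjc isCompact_Icc
      (s := Icc (-ρ) ρ)
    refine continuous_const.mul (h.congr fun s => ?_)
    exact setIntegral_eq_integral_of_forall_compl_eq_zero fun z hz => by rw [hφmp0 z hz]; ring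
  -- ### the integrand `R` of the energy identity (with `η ≡ 1`) and the functionals `Y`, `G`
  obtain ⟨Rf, hRf⟩ : ∃ Rf : ℝ → ℝ, ∀ s, Rf s =
      -(∫ x, (deriv (deriv H) (F s x) * ‖gradient (F s) x‖ ^ 2 * φ x ^ 2 +
          deriv H (F s x) * ⟪gradient (F s) x, gradient (fun y => φ y ^ 2) x⟫)) +
        (∫ x, H (F s x) * ⟪b s x, gradient (fun y => φ y ^ 2) x⟫) +
        ((∫ x, 2 / cylRadius x * (H (F s x) * fderiv ℝ (fun y => φ y ^ 2) x (eR x))) +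
          2 * radialConst₂ * ∫ z : ℝ, H (F s (meridianPoint (0, z))) * φ (meridianPoint (0, z)) ^ 2) :=
    ⟨_, fun _ => rfl⟩
  obtain ⟨Yf, hYf⟩ : ∃ Yf : ℝ → ℝ, ∀ s, Yf s = ∫ x, H (F s x) * φ x ^ 2 := ⟨_, fun _ => rfl⟩
  obtain ⟨Gf, hGf⟩ : ∃ Gf : ℝ → ℝ, ∀ s, Gf s = ∫ x, deriv H (F s x) ^ 2 * ‖gradient (F s) x‖ ^ 2 * φ x ^ 2 :=
    ⟨_, fun _ => rfl⟩
  have hGf0 : ∀ s, 0 ≤ Gf s := fun s => by rw [hGf]; exact integral_nonneg fun x => by positivity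
  have hVc : Continuous fun s => ∫ x, (deriv (deriv H) (F s x) * ‖gradient (F s) x‖ ^ 2 * φ x ^ 2 +
      deriv H (F s x) * ⟪gradient (F s) x, gradient (fun y => φ y ^ 2) x⟫) :=
    continuous_integral_of_continuous_of_support
      ((((hH''c.comp hFc).mul (hF1c.norm.pow 2)).mul ((hφ.continuous.comp continuous_snd).pow 2)).add
        (hH'Fc.mul (hF1c.inner (hgradφ2c.comp continuous_snd))))
      hKc (fun s x hx => by rw [hφ0K x hx, hgradφ2K x hx, inner_zero_right]; ring)
  have hRi : IntervalIntegrable Rf volume (-ρ ^ 2) 0 := by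
    have h := (((hVc.intervalIntegrable (-ρ ^ 2) 0).neg.add hT₂i).add
      (hT₃i.add (hBdc.intervalIntegrable (-ρ ^ 2) 0)))
    refine h.congr_ae (ae_of_all _ fun s => ?_)
    simp only [Pi.neg_apply]
    rw [hRf s]
  -- ### the energy identity on every `[s₁, s₂] ⊆ [−ρ², 0]`
  have hslici : ∀ s, Integrable (fun x => H (F s x) * φ x ^ 2) (volume : Measure (EuclideanSpace ℝ (Fin 3))) :=
    fun s => ((hH.continuous.comp (hF2 s).continuous).mul hφ2c).integrable_of_hasCompactSupport hφ2cs.mul_left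
  have hY : ∀ s₁ s₂, -ρ ^ 2 ≤ s₁ → s₁ ≤ s₂ → s₂ ≤ 0 → Yf s₂ - Yf s₁ = ∫ s in s₁..s₂, Rf s := by
    intro s₁ s₂ h1 h12 h2
    have hsub : Ioc s₁ s₂ ⊆ Ioc (-ρ ^ 2) 0 := Ioc_subset_Ioc h1 h2
    have hBst₁₂ : ∀ᵐ s ∂(volume.restrict (Ioc s₁ s₂)),
        Differentiable ℝ (Bst s) ∧ curl (Bst s) =ᵐ[volume] b s :=
      ae_restrict_of_ae_restrict_of_subset hsub hBst'
    have heq₁₂ : ∀ᵐ x ∂(volume : Measure (EuclideanSpace ℝ (Fin 3))),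
        IntervalIntegrable (fun s => N s x) volume s₁ s₂ ∧
          ∀ s ∈ Icc s₁ s₂, F s x = F s₁ x + ∫ τ in s₁..s, N τ x := by
      filter_upwards [heq] with x hx
      obtain ⟨hi, hr⟩ := integrated_eq_rebase (Fx := fun s => F s x) (Nx := fun s => N s x) h1 (h12.trans h2)
        hx.1 hx.2
      refine ⟨hi.mono_set ?_, fun s hs => hr s ⟨hs.1, hs.2.trans h2⟩⟩
      rw [uIcc_of_le h12, uIcc_of_le (h12.trans h2)]
      exact Icc_subset_Icc le_rfl h2
    have hint₁₂ : Integrable (fun p : ℝ × EuclideanSpace ℝ (Fin 3) =>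
        (deriv H (F p.1 p.2) * N p.1 p.2 * (fun _ : ℝ => (1 : ℝ)) p.1 +
          H (F p.1 p.2) * deriv (fun _ : ℝ => (1 : ℝ)) p.1) * φ p.2 ^ 2)
        ((volume.restrict (Ioc s₁ s₂)).prod volume) := by
      have h0 := hint0.mono_measure (Measure.prod_mono (Measure.restrict_mono hsub le_rfl) le_rfl)
      refine h0.congr (ae_of_all _ fun p => ?_)
      simp
    have hE := energy_identity_axis h12 hF2 hFa hb hBst₁₂ hN heq₁₂ hH hφ hφcs hφa
      (η := fun _ : ℝ => (1 : ℝ)) contDiff_const hint₁₂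
    have hL : ∫ x, (H (F s₂ x) * (fun _ : ℝ => (1 : ℝ)) s₂ - H (F s₁ x) * (fun _ : ℝ => (1 : ℝ)) s₁) * φ x ^ 2 =
        Yf s₂ - Yf s₁ := by
      rw [hYf, hYf, ← integral_sub (hslici s₂) (hslici s₁)]
      refine integral_congr_ae (ae_of_all _ fun x => ?_)
      simp only [mul_one]; ring
    rw [← hL, hE]
    refine intervalIntegral.integral_congr fun s _ => ?_
    rw [hRf s]
    simp only [deriv_const, one_mul, zero_mul, add_zero]
  -- ### the slice inequality, for a.e. `s ∈ (−ρ², 0]`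
  have hslice : ∀ᵐ s ∂(volume.restrict (Ioc (-ρ ^ 2) 0)),
      Rf s ≤ -(1 / 2) * Gf s + k₁ * ρ - A / Z * Yf s := by
    filter_upwards [hBst, ae_restrict_mem measurableSet_Ioc] with s hs hsI
    obtain ⟨hBd, hBcurl, hBMO⟩ := hs
    have hJN := hC2 (Bst s) hBd.continuous CB hBMO ρ hρ
    have h := log_slice_bound hρ hε (hF2 s) (hFa s) (hFb s (Ioc_subset_Icc_self hsI))
      (hFax s (Ioc_subset_Icc_self hsI)) hH hHeq hHd10 hHd20 (hb s) hBd hBcurl (CB := CB) hC20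
      (hCφ (ρ / 2) ρ hρ2 hρρ) hCT hJN
    rw [← hφdef, ← hV₁] at h
    -- the viscous part of `R` is one integral of a sum
    have hAi : Integrable (fun x => deriv (deriv H) (F s x) * ‖gradient (F s) x‖ ^ 2 * φ x ^ 2)
        (volume : Measure (EuclideanSpace ℝ (Fin 3))) :=
      (((hH''c.comp (hF2 s).continuous).mul ((continuous_gradient_of_contDiff ((hF2 s).of_le one_le_two)).norm.pow 2)).mul
        hφ2c).integrable_of_hasCompactSupport hφ2cs.mul_left
    have hBi : Integrable (fun x => deriv H (F s x) * ⟪gradient (F s) x, gradient (fun y => φ y ^ 2) x⟫)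
        (volume : Measure (EuclideanSpace ℝ (Fin 3))) :=
      ((hH'c.comp (hF2 s).continuous).mul ((continuous_gradient_of_contDiff ((hF2 s).of_le one_le_two)).inner
        hgradφ2c)).integrable_of_hasCompactSupport
        (HasCompactSupport.intro hKc fun x hx => by
          show deriv H (F s x) * ⟪gradient (F s) x, gradient (fun y => φ y ^ 2) x⟫ = 0
          rw [hgradφ2K x hx, inner_zero_right, mul_zero])
    have hsplit := integral_add hAi hBi
    rw [hRf, hsplit, hGf, hYf, hAdef, hZdef, hk₁]
    exact h
  -- `Y ≥ −(log 3) Z` on the cylinder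
  have hYlo : ∀ s ∈ Icc (-ρ ^ 2) 0, -(Real.log 3 * Z) ≤ Yf s := by
    intro s hs
    rw [hYf, hZdef, ← neg_mul, ← MeasureTheory.integral_const_mul]
    refine integral_mono ((hφ2c.integrable_of_hasCompactSupport hφ2cs).const_mul _) (hslici s) fun x => ?_
    by_cases hx : x ∈ K
    · have hb3 := hFb s hs x hx
      have hv : ε / 2 ≤ F s x := (half_le_self hε.le).trans hb3.1
      show -Real.log 3 * φ x ^ 2 ≤ H (F s x) * φ x ^ 2
      rw [hHeq _ hv]
      exact mul_le_mul_of_nonneg_right (neg_le_neg (Real.log_le_log (hε.trans_le hb3.1) hb3.2)) (sq_nonneg _)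
    · show -Real.log 3 * φ x ^ 2 ≤ H (F s x) * φ x ^ 2
      rw [hφ0K x hx]; simp
  -- (D1) `R ≤ kK ρ`
  have hR1 : ∀ᵐ s ∂(volume.restrict (Ioc (-ρ ^ 2) 0)), Rf s ≤ kK * ρ * 1 := by
    filter_upwards [hslice, ae_restrict_mem measurableSet_Ioc] with s hs hsI
    have hy := hYlo s (Ioc_subset_Icc_self hsI)
    have h1 : -(A / Z * Yf s) ≤ A * Real.log 3 := by
      have h2 : -(A / Z * Yf s) ≤ A / Z * (Real.log 3 * Z) := by
        have := mul_le_mul_of_nonneg_left hy (div_nonneg hApos.le hZpos.le)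
        linarith
      have e : A / Z * (Real.log 3 * Z) = A * Real.log 3 := by field_simp
      linarith
    have h3 : A * Real.log 3 ≤ 4 * radialConst₂ * ρ * Real.log 3 := mul_le_mul_of_nonneg_right hA4 hlog3.le
    have h4 := hGf0 s
    have e : kK * ρ * 1 = k₁ * ρ + 4 * radialConst₂ * ρ * Real.log 3 := by rw [hkK]; ring
    rw [e]
    linarith
  -- the thresholds
  set Θ₁ : ℝ := k₁ * ρ * Z / A with hΘ₁
  set Θ : ℝ := max Θ₁ (2 * L₀ * Z) with hΘ
  have hΘpos : 0 < Θ := lt_of_lt_of_le (by positivity) (le_max_right _ _)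
  -- (D3) above `Θ` the axis term absorbs the constant: `R ≤ 0`
  have hR3' : ∀ᵐ s ∂(volume.restrict (Ioc (-ρ ^ 2) 0)), Θ ≤ Yf s → Rf s ≤ -(1 / 2) * Gf s := by
    filter_upwards [hslice] with s hs hΘY
    have h1 : Θ₁ ≤ Yf s := (le_max_left _ _).trans hΘY
    have h2 : k₁ * ρ ≤ A / Z * Yf s := by
      have := mul_le_mul_of_nonneg_left h1 (div_nonneg hApos.le hZpos.le)
      have e : A / Z * Θ₁ = k₁ * ρ := by rw [hΘ₁]; field_simp
      linarith
    linarith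
  have hR3 : ∀ᵐ s ∂(volume.restrict (Ioc (-ρ ^ 2) 0)), Θ ≤ Yf s → Rf s ≤ 0 := by
    filter_upwards [hR3'] with s hs hΘY
    have := hs hΘY
    have := hGf0 s
    linarith
  -- ### the set `W` of times of large mass
  obtain ⟨g, hgdef⟩ : ∃ g : ℝ → ℝ, ∀ s,
      g s = ∫ x in closedBall (0 : EuclideanSpace ℝ (Fin 3)) (ρ / 2), F s x ^ (1 / 4 : ℝ) := ⟨_, fun _ => rfl⟩
  have hgc : Continuous g := by
    have h := continuous_parametric_integral_of_continuous (μ := (volume : Measure (EuclideanSpace ℝ (Fin 3))))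
      (f := fun s x => F s x ^ (1 / 4 : ℝ)) (hFc.rpow_const fun p => Or.inr (by norm_num))
      (isCompact_closedBall (0 : EuclideanSpace ℝ (Fin 3)) (ρ / 2))
    exact h.congr fun s => (hgdef s).symm
  set W : Set ℝ := {s | θ₀ * ρ ^ 3 ≤ g s} ∩ Ioc (-(ρ ^ 2 / 4)) 0 with hW
  have hWm : MeasurableSet W := (isClosed_le continuous_const hgc).measurableSet.inter measurableSet_Ioc
  have hWsub : W ⊆ Ioc (-(ρ ^ 2 / 4)) 0 := inter_subset_right
  have hKhalf : closedBall (0 : EuclideanSpace ℝ (Fin 3)) (ρ / 2) ⊆ K := closedBall_subset_closedBall hρρ.le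
  have hgG : ∀ s ∈ Ioc (-(ρ ^ 2 / 4)) 0, g s ≤ 3 * volume.real (closedBall (0 : EuclideanSpace ℝ (Fin 3)) (ρ / 2)) := by
    intro s hs
    have hsI : s ∈ Icc (-ρ ^ 2) 0 := ⟨hq1.trans hs.1.le, hs.2⟩
    have hpt : ∀ x ∈ closedBall (0 : EuclideanSpace ℝ (Fin 3)) (ρ / 2), F s x ^ (1 / 4 : ℝ) ≤ 3 := by
      intro x hx
      obtain ⟨hlo, hhi⟩ := hFb s hsI x (hKhalf hx)
      have hF0 : 0 ≤ F s x := hε.le.trans hlo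
      rcases le_or_gt 1 (F s x) with h1 | h1
      · calc F s x ^ (1 / 4 : ℝ) ≤ F s x ^ (1 : ℝ) := Real.rpow_le_rpow_of_exponent_le h1 (by norm_num)
          _ = F s x := Real.rpow_one _
          _ ≤ 3 := hhi
      · exact (Real.rpow_le_one hF0 h1.le (by norm_num)).trans (by norm_num)
    rw [hgdef]
    calc ∫ x in closedBall (0 : EuclideanSpace ℝ (Fin 3)) (ρ / 2), F s x ^ (1 / 4 : ℝ)
        ≤ ∫ x in closedBall (0 : EuclideanSpace ℝ (Fin 3)) (ρ / 2), (3 : ℝ) :=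
          setIntegral_mono_on (((hF2 s).continuous.rpow_const fun x => Or.inr (by norm_num)).continuousOn.integrableOn_compact
            (isCompact_closedBall _ _)) (integrableOn_const measure_closedBall_lt_top.ne) measurableSet_closedBall hpt
      _ = 3 * volume.real (closedBall (0 : EuclideanSpace ℝ (Fin 3)) (ρ / 2)) := by
          rw [setIntegral_const, smul_eq_mul, mul_comm]
  have hmW : m₀ * ρ ^ 5 ≤ ∫ s in Ioc (-(ρ ^ 2 / 4)) 0, g s := by
    rw [← intervalIntegral.integral_of_le hq0]
    refine hmass.trans (le_of_eq (intervalIntegral.integral_congr fun s _ => (hgdef s).symm))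
  have hGm : 0 < 3 * volume.real (closedBall (0 : EuclideanSpace ℝ (Fin 3)) (ρ / 2)) := by
    rw [hVhalf]; positivity
  have hWvol0 := measureReal_superlevel_ge hgc hq0 (θ := θ₀ * ρ ^ 3) (by positivity) hGm hgG hmW
  have hWvol : γ * ρ ^ 2 ≤ volume.real W := by
    refine le_trans (le_of_eq ?_) hWvol0
    rw [hVhalf, hγ, hθ₀]
    field_simp
    ring
  -- (D2) on `W`, above `Θ`: Nash–Poincaré gives `R ≤ −a₀ Y²`
  set a₀ : ℝ := w₀ ^ 2 / (9216 * ρ ^ 2 * Z) / 2 with ha₀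
  have ha₀pos : 0 < a₀ := by positivity
  have hFφi : ∀ s, Integrable (fun x => F s x * φ x ^ 2) (volume : Measure (EuclideanSpace ℝ (Fin 3))) :=
    fun s => ((hF2 s).continuous.mul hφ2c).integrable_of_hasCompactSupport hφ2cs.mul_left
  have hR2 : ∀ᵐ s ∂(volume.restrict (Ioc (-ρ ^ 2) 0)), s ∈ W → Θ ≤ Yf s → Rf s ≤ -(a₀ * Yf s ^ 2) := by
    filter_upwards [hR3', ae_restrict_mem measurableSet_Ioc] with s hs hsI hsW hΘY
    have hsIcc : s ∈ Icc (-ρ ^ 2) 0 := Ioc_subset_Icc_self hsI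
    -- the mass on the half ball at this time
    have hgs : θ₀ * ρ ^ 3 ≤ ∫ x in closedBall (0 : EuclideanSpace ℝ (Fin 3)) (ρ / 2), F s x ^ (1 / 4 : ℝ) := by
      rw [← hgdef]; exact hsW.1
    have hVh0 : 0 < volume.real (closedBall (0 : EuclideanSpace ℝ (Fin 3)) (ρ / 2)) := by rw [hVhalf]; positivity
    have hF0h : ∀ x ∈ closedBall (0 : EuclideanSpace ℝ (Fin 3)) (ρ / 2), 0 ≤ F s x := fun x hx =>
      hε.le.trans (hFb s hsIcc x (hKhalf hx)).1
    have hFi : IntegrableOn (F s) (closedBall (0 : EuclideanSpace ℝ (Fin 3)) (ρ / 2)) volume :=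
      (hF2 s).continuous.continuousOn.integrableOn_compact (isCompact_closedBall _ _)
    have hFqi : IntegrableOn (fun x => F s x ^ (1 / 4 : ℝ)) (closedBall (0 : EuclideanSpace ℝ (Fin 3)) (ρ / 2)) volume :=
      ((hF2 s).continuous.rpow_const fun x => Or.inr (by norm_num)).continuousOn.integrableOn_compact
        (isCompact_closedBall _ _)
    have hAM := setIntegral_ge_of_setIntegral_rpow_quarter measurableSet_closedBall measure_closedBall_lt_top.ne
      hVh0 hF0h hFi hFqi
    have hm₁ρ : m₁ * ρ ^ 3 ≤ ∫ x in closedBall (0 : EuclideanSpace ℝ (Fin 3)) (ρ / 2), F s x := by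
      refine le_trans ?_ hAM
      have hg4 := pow_le_pow_left₀ (by positivity) hgs 4
      rw [hVhalf]
      have hV3 : 0 < ((ρ / 2) ^ 3 * V₁) ^ 3 := by positivity
      rw [le_div_iff₀ hV3, hm₁]
      have e : 16 / 27 * θ₀ ^ 4 * 512 / V₁ ^ 3 * ρ ^ 3 * ((ρ / 2) ^ 3 * V₁) ^ 3 = 16 / 27 * (θ₀ * ρ ^ 3) ^ 4 := by
        field_simp; ring
      rw [e]
      exact mul_le_mul_of_nonneg_left hg4 (by norm_num)
    have hmass_s : w₀ * Z ≤ ∫ x, F s x * φ x ^ 2 := by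
      have h1 : w₀ * Z ≤ m₁ * ρ ^ 3 := by
        rw [hw₀]
        calc m₁ / V₁ * Z ≤ m₁ / V₁ * (ρ ^ 3 * V₁) := mul_le_mul_of_nonneg_left hZV (by positivity)
          _ = m₁ * ρ ^ 3 := by field_simp
      refine h1.trans (hm₁ρ.trans ?_)
      calc ∫ x in closedBall (0 : EuclideanSpace ℝ (Fin 3)) (ρ / 2), F s x
          = ∫ x in closedBall (0 : EuclideanSpace ℝ (Fin 3)) (ρ / 2), F s x * φ x ^ 2 :=
            setIntegral_congr_fun measurableSet_closedBall fun x hx => by rw [hφone x hx]; ring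
        _ ≤ ∫ x, F s x * φ x ^ 2 := by
            refine setIntegral_le_integral (hFφi s) (ae_of_all _ fun x => ?_)
            show (0 : ℝ) ≤ F s x * φ x ^ 2
            by_cases hx : x ∈ K
            · exact mul_nonneg (hε.le.trans (hFb s hsIcc x hx).1) (sq_nonneg _)
            · rw [hφ0K x hx]; simp
    have hYs : 2 * L₀ * Z ≤ Yf s := (le_max_right _ _).trans hΘY
    have hNP := nash_poincare_lower hρ hε ((hF2 s).of_le one_le_two) (hFb s hsIcc) hH1 hHeq hw₀0 hL₀0.le hL₀'
      (by rw [← hφdef, ← hZdef]; exact hmass_s) (by rw [← hφdef, ← hZdef, ← hYf]; exact hYs)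
    rw [← hφdef, ← hZdef, ← hYf, ← hGf] at hNP
    have h1 := hs hΘY
    rw [ha₀]
    have e : w₀ ^ 2 / (9216 * ρ ^ 2 * Z) / 2 * Yf s ^ 2 = (1 / 2) * (w₀ ^ 2 / (9216 * ρ ^ 2 * Z) * Yf s ^ 2) := by ring
    rw [e]
    linarith
  -- ### the time argument
  have hT0 : 0 < ρ ^ 2 := by positivity
  have hR1' : ∀ᵐ s ∂(volume.restrict (Ioc (-ρ ^ 2) 0)), Rf s ≤ kK * ρ := by
    filter_upwards [hR1] with s hs; simpa using hs
  have hWsub' : W ⊆ Ioc (-(ρ ^ 2 / 4)) 0 := hWsub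
  have htime := le_threshold_or_riccati (Y := Yf) (R := Rf) (T := ρ ^ 2) (K := kK * ρ) hT0 (by positivity) hΘpos
    ha₀pos hγ0 hRi hY hWm hWsub' hWvol hR1' hR2 hR3
  -- ### conclusion
  have htI : t ∈ Icc (-(γ * ρ ^ 2 / 2)) 0 := by
    refine ⟨le_trans ?_ ht.1, ht.2⟩
    have : ct * ρ ^ 2 ≤ γ / 2 * ρ ^ 2 := mul_le_mul_of_nonneg_right (min_le_left _ _) (sq_nonneg _)
    linarith
  have hYt := htime t htI
  have htIcc : t ∈ Icc (-ρ ^ 2) 0 := by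
    refine ⟨le_trans ?_ ht.1, ht.2⟩
    have : ct * ρ ^ 2 ≤ 1 / 8 * ρ ^ 2 := mul_le_mul_of_nonneg_right (min_le_right _ _) (sq_nonneg _)
    nlinarith
  -- `∫ (−log F t) φ² = Y t`
  have hYeq : ∫ x, -Real.log (F t x) * φ x ^ 2 = Yf t := by
    rw [hYf]
    refine integral_congr_ae (ae_of_all _ fun x => ?_)
    dsimp only
    by_cases hx : x ∈ K
    · rw [hHeq _ ((half_le_self hε.le).trans (hFb t htIcc x hx).1)]
    · rw [hφ0K x hx]; simp
  rw [hYeq]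
  refine hYt.trans ?_
  -- the constants: `max Θ (2/(a₀γρ²)) + kKρ·ρ² ≤ M₀ ρ³`
  have hΘ₁le : Θ₁ ≤ k₁ * V₁ / (2 * radialConst₂) * ρ ^ 3 := by
    rw [hΘ₁, div_le_iff₀ hApos]
    calc k₁ * ρ * Z ≤ k₁ * ρ * (ρ ^ 3 * V₁) := mul_le_mul_of_nonneg_left hZV (by positivity)
      _ = k₁ * V₁ / (2 * radialConst₂) * ρ ^ 3 * (2 * radialConst₂ * ρ) := by field_simp
      _ ≤ k₁ * V₁ / (2 * radialConst₂) * ρ ^ 3 * A := mul_le_mul_of_nonneg_left hA2 (by positivity)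
  have hΘ₂le : 2 * L₀ * Z ≤ 2 * L₀ * V₁ * ρ ^ 3 := by
    calc 2 * L₀ * Z ≤ 2 * L₀ * (ρ ^ 3 * V₁) := mul_le_mul_of_nonneg_left hZV (by positivity)
      _ = 2 * L₀ * V₁ * ρ ^ 3 := by ring
  have hΘle : Θ ≤ (k₁ * V₁ / (2 * radialConst₂) + 2 * L₀ * V₁) * ρ ^ 3 := by
    rw [hΘ]
    refine max_le ?_ ?_
    · have : 0 ≤ 2 * L₀ * V₁ * ρ ^ 3 := by positivity
      linarith
    · have : 0 ≤ k₁ * V₁ / (2 * radialConst₂) * ρ ^ 3 := by positivity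
      linarith
  have hRic : 2 / (a₀ * γ * ρ ^ 2) ≤ 36864 * V₁ / (w₀ ^ 2 * γ) * ρ ^ 3 := by
    rw [ha₀]
    have e : 2 / (w₀ ^ 2 / (9216 * ρ ^ 2 * Z) / 2 * γ * ρ ^ 2) = 36864 / (w₀ ^ 2 * γ) * Z := by
      field_simp
      ring
    rw [e]
    calc 36864 / (w₀ ^ 2 * γ) * Z ≤ 36864 / (w₀ ^ 2 * γ) * (ρ ^ 3 * V₁) := mul_le_mul_of_nonneg_left hZV (by positivity)
      _ = 36864 * V₁ / (w₀ ^ 2 * γ) * ρ ^ 3 := by ring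
  have hmax : max Θ (2 / (a₀ * γ * ρ ^ 2)) ≤ (k₁ * V₁ / (2 * radialConst₂) + 2 * L₀ * V₁ + 36864 * V₁ / (w₀ ^ 2 * γ)) * ρ ^ 3 := by
    refine max_le ?_ ?_
    · have : 0 ≤ 36864 * V₁ / (w₀ ^ 2 * γ) * ρ ^ 3 := by positivity
      linarith
    · have : 0 ≤ (k₁ * V₁ / (2 * radialConst₂) + 2 * L₀ * V₁) * ρ ^ 3 := by positivity
      linarith
  rw [hM₀]
  have e : kK * ρ * ρ ^ 2 = kK * ρ ^ 3 := by ring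
  rw [e]
  linarith [hmax]

end LeiZhang2011

end Literature.Analysis.FluidPDE
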